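import Summits.Ventures.PercRepro.C026Class

/-!
# PercRepro — the one-edge monotonicity of the C-026 class slack, and C-026 from it (p1, gen 5)

mine-3's class-level target form of the contraction condition `(Con)` (dossier
`proofs/MINE3-Q3-proof.md` §16, addendum 2; lead rulings INBOX 2118 (ih)(2) and 2142): the class slack
`CFslack(G) = #OnePair − #{S : a ~_S b ∧ c iso in S̄}` (`cubeSumQuad_kernel26_eq`) does not decrease when an
edge is ADDED, provided the edge is not of type `a/b–non-mark` (one endpoint a mark `a` or `b`, the other none
of `a, b, c`) — equivalently, deleting such an edge does not increase the slack.  Exact census: 0 decreases at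
`c`-edges, non-mark edges and mark–mark edges on every graph with `n ≤ 8`, `m ≤ 11` (mine-3 g9, INBOX 2119);
at `a/b–non-mark` edges the slack does decrease (first witness `n = 5`).

* **`deleteEdge`** — the multigraph `G − e` on the edges `{f // f ≠ e}` (`IsSimple.deleteEdge`: simple stays
  simple);
* **`IsABNonMarkEdge`** — the edge type at which the monotonicity may fail;
* **`OneEdgeMonoC026`** — the typed hypothesis, asked exactly where the census looked: for every SIMPLE graph
  (no loops, no parallel edges), every three distinct marks and every edge `e` not of type `a/b–non-mark`,
  `CS(G − e) ≤ CS(G)` for the kernel `kernel26`.  Loops and parallel edges are NOT in the hypothesis: at a loop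
  the class sum doubles (`cubeSumQuad_loop`) and at a parallel pair `CS = CS(G − e') + 2·CS(G/e − e')`
  (`cubeSumQuad_parallel`), so «monotonicity» there is C-026 itself on a smaller minor — typer-2's reduction
  `ClassPositiveUpTo_of_simple` absorbs both;
* **`cubeSumQuad_kernel26_nonneg_of_oneEdgeMono`** — the kernel implication: under the hypothesis the class
  sum of `kernel26` is nonnegative on every simple graph with three distinct marks (strong induction on the
  number of edges: delete a removable edge and use the hypothesis; with no removable edge left, every edge
  joins `a` or `b` to a non-mark, so `c` is isolated and the kernel vanishes pointwise);
* **`classPositiveSimpleInjUpTo_kernel26_of_oneEdgeMono`**, **`C026UpTo_of_oneEdgeMono`** — hence the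
  injective simple-graph census hypothesis on ≤ N vertices for every N and, by p5's `C026UpTo_of_simpleInj`
  (repeated marks, loops and parallel edges, then the antipodal principle), C-026 at every `p ∈ [0,1]^E` on
  every multigraph with ≤ N vertices, for every N.
-/

namespace PercRepro

open Finset

namespace MultiGraph

variable {V E : Type*} (G : MultiGraph V E)

/-! ### The multigraph `G − e` and the edge types -/

/-- **The multigraph `G − e`**: the same vertices, the edges of `G` other than `e`. -/
def deleteEdge (e : E) : MultiGraph V {f : E // f ≠ e} where
  fst f := G.fst f.1
  snd f := G.snd f.1

/-- The first endpoint of an edge of `G − e` is its first endpoint in `G`. -/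
@[simp] theorem deleteEdge_fst (e : E) (f : {f : E // f ≠ e}) :
    (G.deleteEdge e).fst f = G.fst f.1 := rfl

/-- The second endpoint of an edge of `G − e` is its second endpoint in `G`. -/
@[simp] theorem deleteEdge_snd (e : E) (f : {f : E // f ≠ e}) :
    (G.deleteEdge e).snd f = G.snd f.1 := rfl

/-- `G − e` is simple when `G` is (no loops, no parallel edges). -/
theorem IsSimple.deleteEdge (hs : G.IsSimple) (e : E) : (G.deleteEdge e).IsSimple :=
  ⟨fun f => hs.1 f.1, fun f f' hff' => Subtype.ext (hs.2 f.1 f'.1 hff')⟩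

/-- **An edge of type `a/b–non-mark`** (endpoints read against the marks `a, b, c`): one endpoint is `a`
or `b`, the other is none of `a, b, c`.  These are the edges at which the C-026 class slack may decrease
when the edge is added (mine-3 §16 add. 2 (b)); every other edge of a simple graph — mark–mark edges,
`c`-edges, edges between non-marks — is *removable*. -/
def IsABNonMarkEdge (a b c : V) (e : E) : Prop :=
  ((G.fst e = a ∨ G.fst e = b) ∧ G.snd e ≠ a ∧ G.snd e ≠ b ∧ G.snd e ≠ c) ∨
    ((G.snd e = a ∨ G.snd e = b) ∧ G.fst e ≠ a ∧ G.fst e ≠ b ∧ G.fst e ≠ c)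

/-- If every edge is of type `a/b–non-mark`, no edge has `c` as an endpoint. -/
theorem not_endpoint_of_forall_abNonMark {a b c : V} (hac : a ≠ c) (hbc : b ≠ c)
    (h : ∀ e, G.IsABNonMarkEdge a b c e) (e : E) : G.fst e ≠ c ∧ G.snd e ≠ c := by
  rcases h e with ⟨h1, -, -, h3⟩ | ⟨h1, -, -, h3⟩
  · refine ⟨?_, h3⟩
    rcases h1 with h1 | h1 <;> rw [h1] <;> assumption
  · refine ⟨h3, ?_⟩
    rcases h1 with h1 | h1 <;> rw [h1] <;> assumption

/-- A vertex with no edge at it is connected to nothing but itself. -/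
theorem not_conn_of_not_endpoint {c : V} (hc : ∀ e, G.fst e ≠ c ∧ G.snd e ≠ c) (ω : Config E)
    {u : V} (hu : u ≠ c) : ¬ G.Conn ω u c :=
  fun h => hu (G.eq_of_conn_of_isolated (fun e _ => hc e) h.symm)

/-! ### The kernel vanishes when `c` is isolated -/

/-- **With `c` isolated the kernel of C-026 vanishes pointwise**: the only cells are `ab|c` and `bot`,
`c` is isolated in every configuration, and `[one pair] = [a ~ b]`. -/
theorem kernel26_eq_zero_of_not_endpoint {a b c : V} (hac : a ≠ c) (hbc : b ≠ c)
    (hc : ∀ e, G.fst e ≠ c ∧ G.snd e ≠ c) (ρ : Config E) :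
    kernel26 (G.markedPartition ρ ![a, b, c]) (G.markedPartition ρᶜ ![a, b, c]) = 0 := by
  rw [G.kernel26_eq_ite]
  have h1 : ¬ G.Conn ρ a c := G.not_conn_of_not_endpoint hc ρ hac
  have h2 : ¬ G.Conn ρ b c := G.not_conn_of_not_endpoint hc ρ hbc
  have h3 : ¬ G.Conn ρᶜ a c := G.not_conn_of_not_endpoint hc ρᶜ hac
  have h4 : ¬ G.Conn ρᶜ b c := G.not_conn_of_not_endpoint hc ρᶜ hbc
  have hOne : G.OnePair ρ a b c ↔ G.Conn ρ a b := by
    constructor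
    · rintro (⟨h, -⟩ | ⟨h, -⟩ | ⟨h, -⟩)
      · exact h
      · exact absurd h h1
      · exact absurd h h2
    · intro h
      exact Or.inl ⟨h, h1⟩
  have hIso : G.IsCIso ρᶜ a b c := ⟨h3, h4⟩
  by_cases hab : G.Conn ρ a b
  · rw [if_pos (hOne.2 hab), if_pos ⟨hab, hIso⟩]
    norm_num
  · rw [if_neg (fun h => hab (hOne.1 h)), if_neg (fun h => hab h.1)]
    norm_num

variable [Fintype E] [DecidableEq E]

/-- **With `c` isolated the C-026 class sum is zero.** -/
theorem cubeSumQuad_kernel26_eq_zero_of_not_endpoint {a b c : V} (hac : a ≠ c) (hbc : b ≠ c)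
    (hc : ∀ e, G.fst e ≠ c ∧ G.snd e ≠ c) : G.cubeSumQuad ![a, b, c] kernel26 = 0 := by
  unfold cubeSumQuad cubeSum
  exact Finset.sum_eq_zero fun ρ _ => G.kernel26_eq_zero_of_not_endpoint hac hbc hc ρ

end MultiGraph

/-! ### The typed hypothesis and the kernel implication -/

/-- **The one-edge monotonicity of the C-026 class slack** (mine-3's class-level form of `(Con)`,
`proofs/MINE3-Q3-proof.md` §16 add. 2; admitted as the target form by lead ruling INBOX 2118 (ih)(2)):
for every SIMPLE marked graph (no loops, no parallel edges) with three distinct marks `a, b, c` and every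
edge `e` NOT of type `a/b–non-mark`, deleting `e` does not increase the class sum of `kernel26`:
`CS(G − e) ≤ CS(G)`, where `CS(G) = #OnePair − #{S : a ~_S b ∧ c iso in S̄}` (`cubeSumQuad_kernel26_eq`).
Exact census (mine-3 g9, INBOX 2119): 0 decreases at `c`-edges, non-mark edges and mark–mark edges on every
simple graph with `n ≤ 8` vertices and `m ≤ 11` edges, every ordered marking.  Loops and parallel edges are
absorbed by typer-2's reduction to simple graphs (`ClassPositiveUpTo_of_simple`), see the module docstring. -/
def OneEdgeMonoC026 : Prop :=
  ∀ {V E : Type} [Fintype V] [Fintype E] [DecidableEq E] (G : MultiGraph V E), G.IsSimple →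
    ∀ a b c : V, a ≠ b → a ≠ c → b ≠ c → ∀ e : E, ¬ G.IsABNonMarkEdge a b c e →
      (G.deleteEdge e).cubeSumQuad ![a, b, c] kernel26 ≤ G.cubeSumQuad ![a, b, c] kernel26

/-- **The C-026 class sum is nonnegative on every simple graph with three distinct marks, given the
one-edge monotonicity** (strong induction on the number of edges): delete a removable edge and apply the
hypothesis, or — if every edge is of type `a/b–non-mark` — `c` is isolated and the sum is `0`. -/
theorem cubeSumQuad_kernel26_nonneg_of_oneEdgeMono (h : OneEdgeMonoC026) (n : ℕ) :
    ∀ {V E : Type} [Fintype V] [Fintype E] [DecidableEq E], Fintype.card E = n →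
      ∀ (G : MultiGraph V E), G.IsSimple → ∀ m : Fin 3 → V, Function.Injective m →
        0 ≤ G.cubeSumQuad m kernel26 := by
  induction n using Nat.strong_induction_on with
  | _ n ih =>
    intro V E _ _ _ hn G hs m hm
    have hm' : m = ![m 0, m 1, m 2] := by
      funext i
      fin_cases i <;> rfl
    have h01 : m 0 ≠ m 1 := fun h => absurd (hm h) (by decide)
    have h02 : m 0 ≠ m 2 := fun h => absurd (hm h) (by decide)
    have h12 : m 1 ≠ m 2 := fun h => absurd (hm h) (by decide)
    by_cases hall : ∀ e, G.IsABNonMarkEdge (m 0) (m 1) (m 2) e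
    · rw [hm', G.cubeSumQuad_kernel26_eq_zero_of_not_endpoint h02 h12
        (G.not_endpoint_of_forall_abNonMark h02 h12 hall)]
    · obtain ⟨e, he⟩ := not_forall.1 hall
      have hlt : Fintype.card {f : E // f ≠ e} < n := by
        rw [← hn]
        exact Fintype.card_subtype_lt fun h => h rfl
      have ih' := ih _ hlt rfl (G.deleteEdge e) (MultiGraph.IsSimple.deleteEdge G hs e)
        ![m 0, m 1, m 2] (by rw [← hm']; exact hm)
      rw [hm']
      exact le_trans ih' (h G hs (m 0) (m 1) (m 2) h01 h02 h12 e he)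

/-- **The injective simple-graph census hypothesis for `kernel26` on ≤ N vertices, for every N, given the
one-edge monotonicity.** -/
theorem classPositiveSimpleInjUpTo_kernel26_of_oneEdgeMono (h : OneEdgeMonoC026) (N : ℕ) :
    ClassPositiveSimpleInjUpTo 3 N kernel26 := by
  intro V E _ _ _ _ G hs m hm
  exact cubeSumQuad_kernel26_nonneg_of_oneEdgeMono h _ rfl G hs m hm

/-- **C-026 from the one-edge monotonicity** (mine-3 §16 add. 2 (c), in the kernel): the one-edge
monotonicity of the class slack on simple graphs implies C-026 at every `p ∈ [0,1]^E` on every multigraph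
with ≤ N vertices, for every N — by p5's `C026UpTo_of_simpleInj` (repeated marks, then typer-2's reduction of
loops and parallel edges to simple graphs, then the antipodal principle). -/
theorem C026UpTo_of_oneEdgeMono (h : OneEdgeMonoC026) (N : ℕ) : C026UpTo N :=
  C026UpTo_of_simpleInj (classPositiveSimpleInjUpTo_kernel26_of_oneEdgeMono h N)

end PercRepro
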